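import Summits.Schanuel.Schanuel.Theorems.DiophantineDichotomyApproximationPropertyZeroDimDictionary
import Summits.Schanuel.Schanuel.Theorems.DiophantineDichotomyApproximationPropertySharpClosestPointLemmas
import Literature.Combinatorics.Extremal.LowDegreeSurfaceThroughLines
import Literature.FieldTheory.QuasiAlgClosed.Basic
import Mathlib.RingTheory.MvPolynomial.Homogeneous
import Mathlib.Algebra.CharZero.Infinite
import HarnessLib

/-!
# Collinear Galois orbits drag their line into every low-degree hypersurface through them (helper for crux `ApproximationProperty`, stmt-Schanuel-6117)

Route `DiophantineDichotomy` (sub-problem `Schanuel/Schanuel`), line `orbit-interpolation-determinant`,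
lead c2 (`prover-line-stmt-Schanuel-6117-c2-0`, 2026-08-16). Structure lemma for the bad-orbit analysis of
the interpolation clause at `t = 3` (lead NOTES §Clause): the clause fails most simply for COLLINEAR orbits
(`D` collinear points impose only `min(D, s+1)` conditions on forms of degree `s`). This file shows that
such an orbit, if long, is trapped: let `𝔭 ⊂ ℚ[x₀, …, x_m]` be a 0-dimensional homogeneous prime
(`IsUnmixedOfRank 𝔭 1`, a Galois orbit of `D = ideg 𝔭 1` points by the landed dictionary
`ZeroDimDictionary`) all of whose projective zeros lie on the complex line through `p, q`; then every
rational form `F` of degree `d < D` vanishing on the orbit vanishes on the WHOLE line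
(`line_subset_of_collinear_orbit`, registered helper sub-goal). Proof: the dictionary gives `D` pairwise
non-proportional zeros `σ ∘ b` (one for each embedding `σ : K →+* ℂ`, `[K:ℚ] = D`,
`NumberField.Embeddings.card`); their line coordinates are pairwise non-proportional, so Bézout for a
line (`form_vanishes_on_line`, landed as p116689; used here through a private adapted copy because the check farm
has not built that module yet) applies to `map (algebraMap ℚ ℂ) F`.

Consequence used by the lead: a collinear orbit inside `V(Q₁) ∩ V(P₂) ∩ V(P₃)` (degrees `a₁, b₂, b₃`)
has at most `max(a₁, b₂, b₃)` points — then the clause holds at level `⌊cΔ⌋ ≥ max − 1` — or its line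
lies in all three hypersurfaces, i.e. IS a side component of the curve section (the "line container").

No new definitions; no named fact; everything used is landed.
-/

noncomputable section

-- `Summit.Schanuel.Schanuel.…` is the mandated summit/sub-problem namespace (single-conjunct summit), hence:
set_option linter.dupNamespace false

attribute [local instance] MvPolynomial.gradedAlgebra

namespace Summit.Schanuel.Schanuel.Cruxes.ApproximationProperty.OrbitInterpolationDeterminant

open Literature.NumberTheory.Transcendental.Nesterenko MvPolynomial
open scoped BigOperators

/-! ### Bézout for a line (private adapted copy of `…LineBezout.lean`) -/

/-- Affine Bézout on a line for a form: if a form `F` of degree `d` vanishes at the points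
`q + t • p`, `t ∈ T`, for a finite set `T` of more than `d` parameters, then it vanishes at
`q + t • p` for every `t` (the restriction of `F` to the affine line is a univariate polynomial
of degree `≤ d` with more than `d` roots). -/
private theorem eval_line_eq_zero_of_lt_card_aux {σ : Type*} {F : MvPolynomial σ ℂ} {d : ℕ}
    (hF : F.IsHomogeneous d) (p q : σ → ℂ) (T : Finset ℂ) (hT : d < T.card)
    (h0 : ∀ t ∈ T, MvPolynomial.eval (q + t • p) F = 0) (t : ℂ) :
    MvPolynomial.eval (q + t • p) F = 0 := by
  rw [← Literature.Combinatorics.Extremal.eval_aeval_line q p F t,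
    Literature.Combinatorics.Extremal.aeval_line_eq_zero_of_totalDegree_lt_card q p F T
      (hF.totalDegree_le.trans_lt hT) h0, Polynomial.eval_zero]

/-- **Bézout for a line against a hypersurface** (PRIVATE adapted copy of the landed `form_vanishes_on_line` of `…LineBezout.lean`, p116689, whose olean is not yet built on the check farm; to be replaced by an import).
A form `F` of degree `d` on `ℂ^{m+1}` having `N > d` zeros `uᵢ • p + vᵢ • q` on the line spanned
by `p, q`, with pairwise non-proportional parameters (`uᵢ vₖ ≠ uₖ vᵢ` for `i ≠ k`), vanishes at
every point `a • p + b • q` of that line. -/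
private theorem form_vanishes_on_line_aux : ∀ (m d N : ℕ) (F : MvPolynomial (Fin (m + 1)) ℂ)
    (p q : Fin (m + 1) → ℂ) (u v : Fin N → ℂ),
    F.IsHomogeneous d → (∀ i k, i ≠ k → u i * v k ≠ u k * v i) →
    (∀ i, MvPolynomial.eval (u i • p + v i • q) F = 0) → d < N →
    ∀ a b : ℂ, MvPolynomial.eval (a • p + b • q) F = 0 := by
  intro m d N F p q u v hF huv hzero hdN a b
  classical
  rcases Nat.eq_zero_or_pos d with hd | hd
  · -- `d = 0`: `F` evaluates constantly (`F x = F (0 • x) = F 0`), and `F` has a zero.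
    subst hd
    have hconst : ∀ x : Fin (m + 1) → ℂ, MvPolynomial.eval x F = MvPolynomial.eval 0 F := by
      intro x
      have h := hF.eval_smul_eq 0 x
      rw [zero_smul, pow_zero, one_mul] at h
      exact h.symm
    have i0 : Fin N := ⟨0, hdN⟩
    rw [hconst (a • p + b • q), ← hconst (u i0 • p + v i0 • q)]
    exact hzero i0
  · -- `0 < d < N`: no zero is the origin.
    have hne : ∀ i, u i ≠ 0 ∨ v i ≠ 0 := by
      intro i
      rcases ne_or_eq (u i) 0 with hu | hu
      · exact Or.inl hu
      rcases ne_or_eq (v i) 0 with hv | hv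
      · exact Or.inr hv
      exfalso
      haveI : Nontrivial (Fin N) := Fin.nontrivial_iff_two_le.mpr (by omega)
      obtain ⟨k, hk⟩ := exists_ne i
      exact huv k i hk (by rw [hu, hv, mul_zero, zero_mul])
    by_cases hab : a = 0 ∧ b = 0
    · -- the origin: `F 0 = 0 ^ d * F p = 0`.
      obtain ⟨rfl, rfl⟩ := hab
      have h0 : (0 : ℂ) • p + (0 : ℂ) • q = (0 : ℂ) • p := by simp
      rw [h0, hF.eval_smul_eq, zero_pow hd.ne', zero_mul]
    · -- shear parameter `l`: avoid the finitely many bad values.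
      obtain ⟨l, hl⟩ := Infinite.exists_notMem_finset
        (insert (-b / a) (Finset.univ.image fun i => -v i / u i))
      have hw : ∀ i, v i + l * u i ≠ 0 := by
        intro i h
        rcases eq_or_ne (u i) 0 with hu | hu
        · rcases hne i with h1 | h1
          · exact h1 hu
          · exact h1 (by simpa [hu] using h)
        · refine hl (Finset.mem_insert_of_mem (Finset.mem_image.mpr ⟨i, Finset.mem_univ _, ?_⟩))
          rw [div_eq_iff hu]
          linear_combination -h
      have hc : b + l * a ≠ 0 := by
        intro h
        rcases eq_or_ne a 0 with ha | ha
        · exact hab ⟨ha, by simpa [ha] using h⟩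
        · refine hl (Finset.mem_insert.mpr (Or.inl ?_))
          rw [eq_div_iff ha]
          linear_combination h
      -- the sheared direction `p'`; the line is `{c • (q + t • p')} ∪ {c • p'}`
      set p' : Fin (m + 1) → ℂ := p - l • q with hp'
      -- every zero lies in the affine chart `q + t • p'`, at parameter `uᵢ / (vᵢ + l uᵢ)`
      have hroot : ∀ i, MvPolynomial.eval (q + (u i / (v i + l * u i)) • p') F = 0 := by
        intro i
        have hinv : (v i + l * u i)⁻¹ * (v i + l * u i) = 1 := inv_mul_cancel₀ (hw i)
        have h1 : q + (u i / (v i + l * u i)) • p' = (v i + l * u i)⁻¹ • (u i • p + v i • q) := by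
          ext j
          simp only [hp', Pi.add_apply, Pi.smul_apply, Pi.sub_apply, smul_eq_mul, div_eq_mul_inv]
          linear_combination (-(q j)) * hinv
        rw [h1, hF.eval_smul_eq, hzero i, mul_zero]
      -- these parameters are pairwise distinct
      have hinj : Function.Injective fun i => u i / (v i + l * u i) := by
        intro i k hik
        by_contra hik'
        simp only at hik
        rw [div_eq_div_iff (hw i) (hw k)] at hik
        exact huv i k hik' (by linear_combination hik)
      have hT : d < (Finset.univ.image fun i => u i / (v i + l * u i)).card := by
        rw [Finset.card_image_of_injective _ hinj, Finset.card_univ, Fintype.card_fin]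
        exact hdN
      -- Bézout on the affine line: `F (q + t • p') = 0` for every `t`
      have hall := eval_line_eq_zero_of_lt_card_aux hF p' q _ hT (fun t ht => by
        obtain ⟨i, _, rfl⟩ := Finset.mem_image.mp ht
        exact hroot i)
      -- the target point is `(b + l a) • (q + t₀ • p')`
      have hinv : (b + l * a)⁻¹ * (b + l * a) = 1 := inv_mul_cancel₀ hc
      have h3 : a • p + b • q = (b + l * a) • (q + (a / (b + l * a)) • p') := by
        ext j
        simp only [hp', Pi.add_apply, Pi.smul_apply, Pi.sub_apply, smul_eq_mul, div_eq_mul_inv]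
        linear_combination (l * a * q j - a * p j) * hinv
      rw [h3, hF.eval_smul_eq, hall, mul_zero]


/-! ### Collinear orbits -/

/-- Two pairs with `u v' = u' v` and `(u', v') ≠ 0` are proportional: `(u, v) = λ (u', v')`. [folklore] -/
theorem exists_eq_smul_pair_of_cross_eq {u v u' v' : ℂ} (h : u * v' = u' * v) (h0 : ¬ (u' = 0 ∧ v' = 0)) :
    ∃ l : ℂ, u = l * u' ∧ v = l * v' := by
  by_cases hu' : u' = 0
  · have hv' : v' ≠ 0 := fun hv' => h0 ⟨hu', hv'⟩
    refine ⟨v / v', ?_, ?_⟩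
    · rw [hu', mul_zero]
      rw [hu', zero_mul] at h
      exact (mul_eq_zero.mp h).resolve_right hv'
    · field_simp
  · refine ⟨u / u', ?_, ?_⟩
    · field_simp
    · rw [div_mul_eq_mul_div, eq_div_iff hu']
      linear_combination -h

/-- **Collinear orbits drag their line** (registered helper sub-goal `line_subset_of_collinear_orbit`).
Let `𝔭 ⊂ ℚ[x₀, …, x_m]` (`m ≥ 1`) be a homogeneous prime with `IsUnmixedOfRank 𝔭 1` all of whose
projective zeros lie on the line `{u p + v q}`, and `F` a rational form of degree `d` vanishing at every
projective zero of `𝔭`. If `d < ideg 𝔭 1` then `F` vanishes at every point `a p + b q` of the line.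
[folklore] -/
theorem line_subset_of_collinear_orbit : ∀ (m : ℕ) (𝔭 : Ideal (Rx m)) (p q : Fin (m + 1) → ℂ)
    (F : Rx m) (d : ℕ), 1 ≤ m → 𝔭.IsPrime → 𝔭.IsHomogeneous (homogeneousSubmodule (Fin (m + 1)) ℚ) →
    IsUnmixedOfRank 𝔭 1 → (∀ β ∈ projZeros 𝔭, ∃ u v : ℂ, β = u • p + v • q) → F.IsHomogeneous d →
    (∀ β ∈ projZeros 𝔭, aeval β F = 0) → d < ideg 𝔭 1 →
    ∀ a b : ℂ, aeval (a • p + b • q) F = 0 := by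
  intro m 𝔭 p q F d hm h𝔭 hhom hunm hline hF hF0 hd a b
  classical
  obtain ⟨c, -, hdict⟩ := stub_zeroDimDictionary m hm
  obtain ⟨K, _, _, bK, hbK, hzeros, hinj, hdeg, -⟩ := hdict 𝔭 h𝔭 hhom hunm
  -- enumerate the `D = [K:ℚ]` embeddings and the corresponding zeros
  set D : ℕ := ideg 𝔭 1 with hDdef
  have hcard : Fintype.card (K →+* ℂ) = D := by
    rw [NumberField.Embeddings.card K ℂ, hdeg]
  let e : Fin D ≃ (K →+* ℂ) := (Fintype.equivFinOfCardEq hcard).symm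
  let β : Fin D → (Fin (m + 1) → ℂ) := fun i j => e i (bK j)
  have hβmem : ∀ i, β i ∈ projZeros 𝔭 := fun i =>
    (hzeros (β i)).mpr ⟨sharp_conj_ne_zero (e i) hbK, e i, 1, by ext j; simp [β]⟩
  -- line coordinates of the zeros
  choose u v huv using fun i => hline (β i) (hβmem i)
  -- they are pairwise non-proportional
  have hnp : ∀ i k, i ≠ k → u i * v k ≠ u k * v i := by
    intro i k hik hcross
    have hk0 : ¬ (u k = 0 ∧ v k = 0) := by
      rintro ⟨hu0, hv0⟩
      apply (hβmem k).1
      rw [huv k, hu0, hv0, zero_smul, zero_smul, add_zero]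
    obtain ⟨l, hl1, hl2⟩ := exists_eq_smul_pair_of_cross_eq hcross hk0
    have hprop : β i = fun j => l * β k j := by
      have : β i = l • β k := by
        rw [huv i, huv k, hl1, hl2, smul_add, mul_smul, mul_smul]
      rw [this]; ext j; simp [Pi.smul_apply, smul_eq_mul]
    have := hinj (e i) (e k) l (by simpa [β] using hprop)
    exact hik (e.injective this)
  -- Bézout for the line, applied to `F` with complex coefficients
  have hFC : (MvPolynomial.map (algebraMap ℚ ℂ) F).IsHomogeneous d := hF.map _
  have hzero : ∀ i, MvPolynomial.eval (u i • p + v i • q) (MvPolynomial.map (algebraMap ℚ ℂ) F) = 0 := by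
    intro i
    rw [eval_map, ← aeval_def, ← huv i]
    exact hF0 _ (hβmem i)
  have hmain := form_vanishes_on_line_aux m d D (MvPolynomial.map (algebraMap ℚ ℂ) F) p q u v hFC hnp
    hzero hd a b
  rwa [eval_map, ← aeval_def] at hmain

end Summit.Schanuel.Schanuel.Cruxes.ApproximationProperty.OrbitInterpolationDeterminant

end
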